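import Mathlib
import HarnessLib

/-!
# Quadratic-form inequalities for the Brascamp–Lieb induction

`Literature/Probability/Distributions/`. Elementary linear algebra over `ℝ` used in the proof of
Brascamp–Lieb 1976, Theorem 4.1 (J. Funct. Anal. 22, pp. 377–378):

* the variational bound `2⟨γ, w⟩ - ⟨w, P w⟩ ≤ ⟨γ, P⁻¹ γ⟩` for a positive definite `P`
  (`two_mul_dotProduct_sub_le_inv`), from which
* the inverse is antitone in the Loewner order (`dotProduct_inv_mulVec_antitone`), and
* the "fiber bound" of the induction step: writing `x = (y, z) ∈ ℝ × ℝⁿ`, `P = [[P₀₀, cᵀ], [c, P_zz]]`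
  (`c = P_{z,0}`), `γ = (γ₀, γ_z)`, for every `t ∈ ℝ`
  `⟨γ_z + t c, P_zz⁻¹ (γ_z + t c)⟩ - 2 t γ₀ - t² P₀₀ ≤ ⟨γ, P⁻¹ γ⟩` (`fiber_quadForm_le`),
  which replaces the `2 × 2`-matrix Schwarz argument leading to (4.10) in the printed proof;
* positivity of the Schur complement `P₀₀ - ⟨c, P_zz⁻¹ c⟩ > 0` (`schur_pos`), which is the
  pointwise input for `g'' > 0` in Theorem 4.2 / (4.7).

Vectors in `Fin (n+1) → ℝ` are split with `Fin.cons`; the `z`-block of `P` is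
`P.submatrix Fin.succ Fin.succ`. Theorems only.

References: H. J. Brascamp, E. H. Lieb, J. Funct. Anal. 22 (1976) 366–389, §4. [BrascampLieb1976]
-/

noncomputable section

open Matrix Finset

namespace Literature.Probability.Distributions

namespace BrascampLiebMatrix

section General

variable {ι : Type*} [Fintype ι]

/-- For a real symmetric matrix, `⟨w, P v⟩ = ⟨v, P w⟩`. [folklore] -/
theorem dotProduct_mulVec_comm_of_symm {P : Matrix ι ι ℝ} (hP : Pᵀ = P) (v w : ι → ℝ) :
    w ⬝ᵥ (P *ᵥ v) = v ⬝ᵥ (P *ᵥ w) := by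
  rw [dotProduct_mulVec, ← mulVec_transpose, hP, dotProduct_comm]

omit [Fintype ι] in
/-- A real positive (semi)definite matrix in Mathlib's sense is symmetric. [folklore] -/
theorem transpose_eq_of_posSemidef {P : Matrix ι ι ℝ} (hP : P.PosSemidef) : Pᵀ = P := by
  have h := hP.isHermitian
  rwa [IsHermitian, conjTranspose_eq_transpose_of_trivial] at h

/-- `⟨v, P v⟩ > 0` for `v ≠ 0` and `P` positive definite (real case). [folklore] -/
theorem dotProduct_mulVec_pos {P : Matrix ι ι ℝ} (hP : P.PosDef) {v : ι → ℝ} (hv : v ≠ 0) :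
    0 < v ⬝ᵥ (P *ᵥ v) := by
  simpa using hP.dotProduct_mulVec_pos hv

/-- Completing the square: for symmetric positive semidefinite `P`,
`2⟨P v, w⟩ - ⟨w, P w⟩ ≤ ⟨v, P v⟩` (the difference is `⟨v - w, P (v - w)⟩`). [folklore] -/
theorem two_mul_dotProduct_sub_le {P : Matrix ι ι ℝ} (hP : P.PosSemidef) (v w : ι → ℝ) :
    2 * ((P *ᵥ v) ⬝ᵥ w) - w ⬝ᵥ (P *ᵥ w) ≤ v ⬝ᵥ (P *ᵥ v) := by
  have hsymm := transpose_eq_of_posSemidef hP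
  have h0 : 0 ≤ (v - w) ⬝ᵥ (P *ᵥ (v - w)) := by
    simpa using hP.dotProduct_mulVec_nonneg (v - w)
  have e1 : (v - w) ⬝ᵥ (P *ᵥ (v - w))
      = v ⬝ᵥ (P *ᵥ v) - v ⬝ᵥ (P *ᵥ w) - (w ⬝ᵥ (P *ᵥ v) - w ⬝ᵥ (P *ᵥ w)) := by
    rw [mulVec_sub, sub_dotProduct, dotProduct_sub, dotProduct_sub]
  have e2 : w ⬝ᵥ (P *ᵥ v) = v ⬝ᵥ (P *ᵥ w) := dotProduct_mulVec_comm_of_symm hsymm v w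
  have e3 : (P *ᵥ v) ⬝ᵥ w = v ⬝ᵥ (P *ᵥ w) := by rw [dotProduct_comm, e2]
  rw [e1, e2] at h0
  rw [e3]
  linarith

variable [DecidableEq ι]

/-- The variational bound for a positive definite matrix:
`2⟨γ, w⟩ - ⟨w, P w⟩ ≤ ⟨γ, P⁻¹ γ⟩` for every `w` (equality at `w = P⁻¹ γ`). [folklore] -/
theorem two_mul_dotProduct_sub_le_inv {P : Matrix ι ι ℝ} (hP : P.PosDef) (γ w : ι → ℝ) :
    2 * (γ ⬝ᵥ w) - w ⬝ᵥ (P *ᵥ w) ≤ γ ⬝ᵥ (P⁻¹ *ᵥ γ) := by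
  have hdet : IsUnit P.det := (Matrix.isUnit_iff_isUnit_det _).1 hP.isUnit
  set v := P⁻¹ *ᵥ γ with hv
  have hγ : P *ᵥ v = γ := by
    rw [hv, mulVec_mulVec, mul_nonsing_inv _ hdet, one_mulVec]
  have key := two_mul_dotProduct_sub_le hP.posSemidef v w
  rw [hγ] at key
  exact key.trans_eq (dotProduct_comm v γ)

/-- `⟨γ, P⁻¹ γ⟩ = 2⟨γ, w⟩ - ⟨w, P w⟩` at `w = P⁻¹ γ`. [folklore] -/
theorem dotProduct_inv_mulVec_eq {P : Matrix ι ι ℝ} (hP : P.PosDef) (γ : ι → ℝ) :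
    γ ⬝ᵥ (P⁻¹ *ᵥ γ) = 2 * (γ ⬝ᵥ (P⁻¹ *ᵥ γ)) - (P⁻¹ *ᵥ γ) ⬝ᵥ (P *ᵥ (P⁻¹ *ᵥ γ)) := by
  have hdet : IsUnit P.det := (Matrix.isUnit_iff_isUnit_det _).1 hP.isUnit
  have hγ : P *ᵥ (P⁻¹ *ᵥ γ) = γ := by
    rw [mulVec_mulVec, mul_nonsing_inv _ hdet, one_mulVec]
  rw [hγ, dotProduct_comm (P⁻¹ *ᵥ γ) γ]
  ring

/-- **The inverse is antitone** on positive definite matrices, in quadratic-form language: if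
`⟨v, A v⟩ ≤ ⟨v, B v⟩` for all `v` then `⟨γ, B⁻¹ γ⟩ ≤ ⟨γ, A⁻¹ γ⟩`. [folklore] -/
theorem dotProduct_inv_mulVec_antitone {A B : Matrix ι ι ℝ} (hA : A.PosDef) (hB : B.PosDef)
    (hAB : ∀ v, v ⬝ᵥ (A *ᵥ v) ≤ v ⬝ᵥ (B *ᵥ v)) (γ : ι → ℝ) :
    γ ⬝ᵥ (B⁻¹ *ᵥ γ) ≤ γ ⬝ᵥ (A⁻¹ *ᵥ γ) := by
  rw [dotProduct_inv_mulVec_eq hB γ]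
  have h1 := hAB (B⁻¹ *ᵥ γ)
  have h2 := two_mul_dotProduct_sub_le_inv hA γ (B⁻¹ *ᵥ γ)
  linarith

/-- `⟨γ, P⁻¹ γ⟩ ≥ 0` for `P` positive definite. [folklore] -/
theorem dotProduct_inv_mulVec_nonneg {P : Matrix ι ι ℝ} (hP : P.PosDef) (γ : ι → ℝ) :
    0 ≤ γ ⬝ᵥ (P⁻¹ *ᵥ γ) := by
  simpa using hP.inv.posSemidef.dotProduct_mulVec_nonneg γ

end General

/-! ### Splitting off the first coordinate -/

section Cons

variable {n : ℕ}

/-- Expansion of `⟨(a, v), P (b, w)⟩` along the first coordinate of `Fin (n+1)`. [folklore] -/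
theorem cons_dotProduct_mulVec_cons (P : Matrix (Fin (n + 1)) (Fin (n + 1)) ℝ) (a b : ℝ)
    (v w : Fin n → ℝ) :
    Fin.cons a v ⬝ᵥ (P *ᵥ Fin.cons b w)
      = a * P 0 0 * b + a * ((fun j => P 0 j.succ) ⬝ᵥ w) + b * (v ⬝ᵥ fun i => P i.succ 0)
        + v ⬝ᵥ (P.submatrix Fin.succ Fin.succ *ᵥ w) := by
  simp only [dotProduct, mulVec, Fin.sum_univ_succ, Fin.cons_zero, Fin.cons_succ, submatrix_apply,
    mul_add, Finset.mul_sum, Finset.sum_add_distrib]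
  ring_nf

/-- `Fin.cons a v = 0 → a = 0`. [folklore] -/
theorem cons_ne_zero_of_head {a : ℝ} (ha : a ≠ 0) (v : Fin n → ℝ) : (Fin.cons a v : Fin (n + 1) → ℝ) ≠ 0 := by
  intro h
  have := congr_fun h 0
  simp [Fin.cons_zero] at this
  exact ha this

/-- The `z`-block of a positive definite matrix is positive definite. [folklore] -/
theorem posDef_submatrix_succ {P : Matrix (Fin (n + 1)) (Fin (n + 1)) ℝ} (hP : P.PosDef) :
    (P.submatrix Fin.succ Fin.succ).PosDef :=
  hP.submatrix (Fin.succ_injective n)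

/-- **Positivity of the Schur complement**: for `P` positive definite on `ℝ × ℝⁿ` with
`c = P_{z,0}`, `P₀₀ - ⟨c, P_zz⁻¹ c⟩ > 0` (test `P` on `(1, -P_zz⁻¹ c)`). This is the pointwise
strict inequality behind `g_yy > 0` in Brascamp–Lieb's (4.7)–(4.8).
[cite: BrascampLieb1976, Thm 4.2 / eq. (4.7)] -/
theorem schur_pos {P : Matrix (Fin (n + 1)) (Fin (n + 1)) ℝ} (hP : P.PosDef) :
    0 < P 0 0 - (fun i => P i.succ 0) ⬝ᵥ ((P.submatrix Fin.succ Fin.succ)⁻¹ *ᵥ fun i => P i.succ 0) := by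
  set S := P.submatrix Fin.succ Fin.succ with hS
  set c : Fin n → ℝ := fun i => P i.succ 0 with hc
  have hSpd : S.PosDef := posDef_submatrix_succ hP
  have hdet : IsUnit S.det := (Matrix.isUnit_iff_isUnit_det _).1 hSpd.isUnit
  have hsymm : Pᵀ = P := transpose_eq_of_posSemidef hP.posSemidef
  have hrow : (fun j => P 0 j.succ) = c := by
    funext j
    have := congr_fun (congr_fun hsymm j.succ) 0
    rwa [transpose_apply] at this
  set wz : Fin n → ℝ := S⁻¹ *ᵥ c with hwz
  have hpos := dotProduct_mulVec_pos hP (cons_ne_zero_of_head one_ne_zero (-wz))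
  rw [cons_dotProduct_mulVec_cons, hrow] at hpos
  have e1 : S *ᵥ wz = c := by
    rw [hwz, mulVec_mulVec, mul_nonsing_inv _ hdet, one_mulVec]
  have e2 : (-wz) ⬝ᵥ (S *ᵥ (-wz)) = c ⬝ᵥ wz := by
    rw [mulVec_neg, neg_dotProduct, dotProduct_neg, neg_neg, e1, dotProduct_comm]
  have e3 : c ⬝ᵥ (-wz) = -(c ⬝ᵥ wz) := dotProduct_neg _ _
  have e4 : (-wz) ⬝ᵥ c = -(c ⬝ᵥ wz) := by rw [neg_dotProduct, dotProduct_comm]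
  rw [e2, e3, e4] at hpos
  show 0 < P 0 0 - c ⬝ᵥ wz
  linarith

/-- **The fiber bound of the induction step.** For `P` positive definite on `ℝ × ℝⁿ`,
`γ = (γ₀, γ_z)`, `c = P_{z,0}` and any `t ∈ ℝ`:
`⟨γ_z + t c, P_zz⁻¹ (γ_z + t c)⟩ - 2 t γ₀ - t² P₀₀ ≤ ⟨γ, P⁻¹ γ⟩`.
Proof: test the variational bound on `w = (-t, P_zz⁻¹(γ_z + t c))`. In Brascamp–Lieb's proof this
is the combination of "Theorem 4.1 for `z ∈ ℝⁿ⁻¹` with `H = λ h + μ f_y`" and the Schwarz step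
(4.10). [cite: BrascampLieb1976, Thm 4.1 (proof, p. 378, (4.9)–(4.10))] -/
theorem fiber_quadForm_le {P : Matrix (Fin (n + 1)) (Fin (n + 1)) ℝ} (hP : P.PosDef)
    (γ : Fin (n + 1) → ℝ) (t : ℝ) :
    let S := P.submatrix Fin.succ Fin.succ
    let c : Fin n → ℝ := fun i => P i.succ 0
    let u : Fin n → ℝ := (fun j => γ j.succ) + t • c
    u ⬝ᵥ (S⁻¹ *ᵥ u) - 2 * t * γ 0 - t ^ 2 * P 0 0 ≤ γ ⬝ᵥ (P⁻¹ *ᵥ γ) := by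
  intro S c u
  have hSpd : S.PosDef := posDef_submatrix_succ hP
  have hdet : IsUnit S.det := (Matrix.isUnit_iff_isUnit_det _).1 hSpd.isUnit
  have hsymm : Pᵀ = P := transpose_eq_of_posSemidef hP.posSemidef
  have hrow : (fun j => P 0 j.succ) = c := by
    funext j
    have := congr_fun (congr_fun hsymm j.succ) 0
    rwa [transpose_apply] at this
  set wz : Fin n → ℝ := S⁻¹ *ᵥ u with hwz
  have key := two_mul_dotProduct_sub_le_inv hP γ (Fin.cons (-t) wz)
  have hγ : γ = Fin.cons (γ 0) (fun j => γ j.succ) := by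
    ext i
    refine Fin.cases ?_ (fun j => ?_) i <;> simp
  have e0 : γ ⬝ᵥ Fin.cons (-t) wz = γ 0 * (-t) + (fun j => γ j.succ) ⬝ᵥ wz := by
    conv_lhs => rw [hγ]
    simp [dotProduct, Fin.sum_univ_succ]
  rw [cons_dotProduct_mulVec_cons, hrow, e0] at key
  have e1 : S *ᵥ wz = u := by
    rw [hwz, mulVec_mulVec, mul_nonsing_inv _ hdet, one_mulVec]
  have e2 : wz ⬝ᵥ (S *ᵥ wz) = u ⬝ᵥ wz := by rw [e1, dotProduct_comm]
  have e3 : wz ⬝ᵥ c = c ⬝ᵥ wz := dotProduct_comm _ _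
  have e4 : u ⬝ᵥ wz = (fun j => γ j.succ) ⬝ᵥ wz + t * (c ⬝ᵥ wz) := by
    show ((fun j => γ j.succ) + t • c) ⬝ᵥ wz = _
    rw [add_dotProduct, smul_dotProduct, smul_eq_mul]
  rw [e2, e3] at key
  show u ⬝ᵥ wz - 2 * t * γ 0 - t ^ 2 * P 0 0 ≤ γ ⬝ᵥ (P⁻¹ *ᵥ γ)
  nlinarith [key, e4]

end Cons

end BrascampLiebMatrix

end Literature.Probability.Distributions
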